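import Literature.NumberTheory.Automorphic.KimSymmetricFourthGL2
import Literature.NumberTheory.EllipticCurves.SymmSquareLogEulerProduct
import HarnessLib

/-!
# KimSymmetricFourthGL2Proofs — the provable `Re s > 1` layer of `Kim2003_symmFourL_nonCM_entire_polyBound`

Companion (proofs only, no new definitions, no new named facts) of
`Literature.NumberTheory.Automorphic.KimSymmetricFourthGL2`, whose single named fact
`Kim2003_symmFourL_nonCM_entire_polyBound` packages, for the newform `f` of a non-CM elliptic curve
`W/ℚ` of level `N`, the good-prime symmetric fourth power Euler product
`L^{(N)}(s, Sym⁴ E) = exp (∑_{p ∤ N} ∑_{k ≥ 1} T₄(P_k) k⁻¹ p^{-ks})`, `P_k = C_k(a_p/√p)`,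
`T₄(x) = x⁴ - 3x² + 1` [KimShahidiCusp2002, §4 p. 194]: (a) absolute convergence on `Re s > 1`,
(b) an ENTIRE continuation `L₄`, (c) `‖L₄ s‖ ≤ C N^K` on `|s - 2| ≤ 3/2`.

## What is proved here

* `abs_cuspCoeff_re_div_sqrt_le_two_of_isNewformOf` — Hasse for the newform of `W`:
  `|a_p(f)/√p| ≤ 2` at every prime (tree theorem `WeierstrassCurve.abs_LFunction_prime_pow_le`).
* (`|C_n(x)| ≤ 2` on `[-2, 2]` is the tree's `SymmSqLogEuler.abs_chebyshevC_eval_le`,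
  `Literature.NumberTheory.EllipticCurves.SymmSquareLogEulerProduct`, reused.)
* `abs_symmFourTrace_le_five` — `|T₄(y)| ≤ 5` on `[-2, 2]`.
* `summable_norm_mul_primePow_cpow` — bounded coefficients `c(p, k)` give absolute convergence of
  `∑_p ∑_k c(p,k) p^{-(k+1)s}` on `Re s > 1` (geometric majorant and `∑_p p^{-σ} < ∞`).
* `Kim2003_symmFourL_nonCM_entire_polyBound.summable_logEuler` — part (a) of the fact, for the
  newform of EVERY elliptic `W/ℚ` (CM or not) and every level.
* `Kim2003_symmFourL_nonCM_entire_polyBound_iff_entire_continuation` — the fact is equivalent to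
  its analytic core (b) + (c).

## What is NOT proved (status of the discharge `…_holds`: triage XL — a theory)

(b) + (c) are, in print, Kim's `Sym⁴` functoriality `GL₂ → GL₅` [Kim2003, Thm. B] — proved there
through the exterior square `∧² : GL₄ → GL₆` (Thm. A, the tree's unproved named fact
`Kim2003_exteriorSquare_GL4`) applied to Kim–Shahidi's `Sym³ : GL₂ → GL₄`, `∧²(A³π) = A⁴π ⊞ ω_π`
[KimShahidiCusp2002, §3.1] — in the strong form `Sym⁴(π) = ⊗_v Sym⁴(π_v)` at every place; the
Kim–Shahidi cuspidality criterion [KimShahidiCusp2002, Thm. 3.3.7 and Prop. 3.3.8] with the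
exclusion of the dihedral/tetrahedral/octahedral types for holomorphic non-CM newforms of weight
`2` [KimShahidi2002, §6]; the Godement–Jacquet theory on `GL₅` (entire continuation, boundedness
in vertical strips, functional equation with explicit gamma factor and conductor)
[GodementJacquet1972, Thm. 13.8]; the conductor bound `q(Sym⁴ π_E) ≤ N^{O(1)}` [Rouse2007,
Lemma 2.1]; and the Phragmén–Lindelöf convexity bound [IwaniecKowalski2004, §5.2]. The tree has
automorphic representations of `GL_n` and Satake parameters, but no local Langlands
correspondence, no conductor of an automorphic representation, no standard `L`-function with
vertical-strip growth, no isobaric sums; the weak (almost-all-places) lifts it does name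
(`Kim2003_exteriorSquare_GL4`, `NewtonThorne2021_exists_cuspidal_symmPowerLift`, both unproved)
do not imply (b): an unmatched unramified place would leave a local factor with poles on
`Re s = 0` in `L^{(N)}`. So nothing here assumes or restates the fact (D-0026).

## References

* H. H. Kim, F. Shahidi, *Cuspidality of symmetric powers with applications*, Duke Math. J. 112
  (2002), 177–197: Thm. 3.3.7 (p. 185), Prop. 3.3.8 (p. 186), §3.1 (p. 180), §4 (p. 194)
  [KimShahidiCusp2002] (held, read).
* H. H. Kim, *Functoriality for the exterior square of `GL₄` and the symmetric fourth of `GL₂`*,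
  J. Amer. Math. Soc. 16 (2003), 139–183, Thms. A, B [Kim2003].
* J. H. Silverman, *The arithmetic of elliptic curves*, 2nd ed. (2009), Thm. V.1.1 [SilvermanAEC2009].
-/

noncomputable section

namespace Literature.NumberTheory.Automorphic

open scoped Real Topology
open Set Filter Metric Complex CongruenceSubgroup
open Literature.NumberTheory.EllipticCurves.ModularForms
open Literature.NumberTheory.LFunctions

/-! ### Hasse at every prime for the newform of an elliptic curve -/

/-- **Hasse at every prime for the newform of an elliptic curve**: if `f` is the newform of
`W/ℚ` (`IsNewformOf W f`, so `a_p(f) = a_p(W)`), then `|a_p(f)/√p| ≤ 2` for every prime `p`, from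
the tree's unconditional bound `WeierstrassCurve.abs_LFunction_prime_pow_le` (`|a_{p^k}(W)| ≤
(k+1) p^{k/2}`, all `p`). [cite: SilvermanAEC2009, Thm. V.1.1] -/
theorem abs_cuspCoeff_re_div_sqrt_le_two_of_isNewformOf {N : ℕ} [NeZero N]
    (W : WeierstrassCurve ℚ) [W.IsElliptic] {f : CuspForm (Gamma0 N) 2} (hf : IsNewformOf W f)
    {p : ℕ} (hp : p.Prime) : |(cuspCoeff f p).re / Real.sqrt p| ≤ 2 := by
  have h := WeierstrassCurve.abs_LFunction_prime_pow_le W hp 1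
  rw [pow_one, pow_one, Nat.cast_one, show (1 : ℝ) + 1 = 2 by norm_num] at h
  have hp0 : 0 < Real.sqrt p := Real.sqrt_pos.mpr (by exact_mod_cast hp.pos)
  rw [hf.2 p, Complex.intCast_re, abs_div, abs_of_pos hp0, div_le_iff₀ hp0]
  exact h

/-! ### The `Re s > 1` layer of the named fact

`|a_p/√p| ≤ 2` puts the argument of the Chebyshev polynomials in `[-2, 2]`, so
`P_k = C_k(a_p/√p) ∈ [-2, 2]`, `|T₄(P_k)| ≤ 5`, and the log-Euler double series is dominated by
`∑_p ∑_k 5 p^{-σ} 2^{-kσ}`, absolutely convergent for `σ = Re s > 1`. -/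

/-- **`|T₄(y)| ≤ 5` on `[-2, 2]`** for `T₄(y) = y⁴ - 3y² + 1`, the trace of the symmetric fourth
power of an element of `SL₂(ℂ)` of trace `y` (so that `T₄(2 cos φ) = 1 + 2 cos 2φ + 2 cos 4φ`).
[cite: KimShahidiCusp2002, §4 p. 194] -/
theorem abs_symmFourTrace_le_five {y : ℝ} (hy : |y| ≤ 2) : |y ^ 4 - 3 * y ^ 2 + 1| ≤ 5 := by
  obtain ⟨h₁, h₂⟩ := abs_le.mp hy
  have ht : y ^ 2 ≤ 4 := by nlinarith
  have ht0 : 0 ≤ y ^ 2 := sq_nonneg y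
  rw [abs_le]
  constructor <;> nlinarith [sq_nonneg (y ^ 2 - 3 / 2)]

/-- **Absolute convergence of a prime-power Dirichlet series with bounded coefficients.** If
`|c(p, k)| ≤ B` for all primes `p` and `k ≥ 0`, then for `Re s > 1` the double series
`∑_p ∑_{k ≥ 0} c(p, k) p^{-(k+1)s}` converges absolutely: each inner series is dominated by the
geometric series `B p^{-σ} (2^{-σ})^k`, and `∑_p p^{-σ} < ∞` (Mathlib `Nat.Primes.summable_rpow`).
[folklore] -/
theorem summable_norm_mul_primePow_cpow {c : Nat.Primes → ℕ → ℝ} {B : ℝ}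
    (hc : ∀ p k, |c p k| ≤ B) {s : ℂ} (hs : 1 < s.re) :
    (∀ p : Nat.Primes, Summable fun k : ℕ ↦
        ‖((c p k : ℝ) : ℂ) * (p : ℂ) ^ (-((k + 1 : ℕ) : ℂ) * s)‖) ∧
      Summable fun p : Nat.Primes ↦ ∑' k : ℕ,
        ‖((c p k : ℝ) : ℂ) * (p : ℂ) ^ (-((k + 1 : ℕ) : ℂ) * s)‖ := by
  have hB : 0 ≤ B := (abs_nonneg _).trans (hc ⟨2, Nat.prime_two⟩ 0)
  set q : ℝ := (2 : ℝ) ^ (-s.re) with hq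
  have hq0 : 0 ≤ q := Real.rpow_nonneg (by norm_num) _
  have hq1 : q < 1 := Real.rpow_lt_one_of_one_lt_of_neg (by norm_num) (by linarith)
  -- the norm of one term and its geometric majorant
  have hterm : ∀ (p : Nat.Primes) (k : ℕ),
      ‖((c p k : ℝ) : ℂ) * (p : ℂ) ^ (-((k + 1 : ℕ) : ℂ) * s)‖ ≤
        B * ((p : ℕ) : ℝ) ^ (-s.re) * q ^ k := by
    intro p k
    have hp : 0 < ((p : ℕ) : ℝ) := by exact_mod_cast p.2.pos
    have hp2 : (2 : ℝ) ≤ ((p : ℕ) : ℝ) := by exact_mod_cast p.2.two_le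
    have hre : (-((k + 1 : ℕ) : ℂ) * s).re = (-s.re) * ((k + 1 : ℕ) : ℝ) := by
      simp [Complex.mul_re]; ring
    have hnorm : ‖((p : ℕ) : ℂ) ^ (-((k + 1 : ℕ) : ℂ) * s)‖ =
        ((p : ℕ) : ℝ) ^ (-s.re) * (((p : ℕ) : ℝ) ^ (-s.re)) ^ k := by
      rw [Complex.norm_natCast_cpow_of_pos p.2.pos, hre, Real.rpow_mul hp.le, Real.rpow_natCast,
        pow_succ']
    have hrq : ((p : ℕ) : ℝ) ^ (-s.re) ≤ q :=
      Real.rpow_le_rpow_of_nonpos (by norm_num) hp2 (by linarith)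
    have hr0 : 0 ≤ ((p : ℕ) : ℝ) ^ (-s.re) := Real.rpow_nonneg hp.le _
    rw [norm_mul, Complex.norm_real, Real.norm_eq_abs, hnorm]
    calc |c p k| * (((p : ℕ) : ℝ) ^ (-s.re) * (((p : ℕ) : ℝ) ^ (-s.re)) ^ k)
        ≤ B * (((p : ℕ) : ℝ) ^ (-s.re) * q ^ k) := by
          gcongr
          exact hc p k
      _ = B * ((p : ℕ) : ℝ) ^ (-s.re) * q ^ k := by ring
  have hinner : ∀ p : Nat.Primes, Summable fun k : ℕ ↦
      ‖((c p k : ℝ) : ℂ) * (p : ℂ) ^ (-((k + 1 : ℕ) : ℂ) * s)‖ := fun p ↦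
    Summable.of_nonneg_of_le (fun _ ↦ norm_nonneg _) (hterm p)
      ((summable_geometric_of_lt_one hq0 hq1).mul_left _)
  refine ⟨hinner, ?_⟩
  refine Summable.of_nonneg_of_le (fun p ↦ tsum_nonneg fun _ ↦ norm_nonneg _) (fun p ↦ ?_)
    ((Nat.Primes.summable_rpow.mpr (by linarith : -s.re < -1)).mul_left (B * (1 - q)⁻¹))
  calc ∑' k : ℕ, ‖((c p k : ℝ) : ℂ) * (p : ℂ) ^ (-((k + 1 : ℕ) : ℂ) * s)‖
      ≤ ∑' k : ℕ, B * ((p : ℕ) : ℝ) ^ (-s.re) * q ^ k :=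
        Summable.tsum_le_tsum (hterm p) (hinner p) ((summable_geometric_of_lt_one hq0 hq1).mul_left _)
    _ = B * (1 - q)⁻¹ * ((p : ℕ) : ℝ) ^ (-s.re) := by
        rw [tsum_mul_left, tsum_geometric_of_lt_one hq0 hq1]; ring

/-- **The `Re s > 1` layer of `Kim2003_symmFourL_nonCM_entire_polyBound` (proved).** For the
newform `f` of ANY elliptic curve `W/ℚ` (CM or not) and `Re s > 1`, the log-Euler coefficients
`c(p, k) = T₄(C_{k+1}(a_p/√p))/(k+1)` (`p ∤ N`; `0` at `p ∣ N`) of the good-prime symmetric fourth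
power Euler product satisfy `|c(p, k)| ≤ 5` (Hasse: `|a_p/√p| ≤ 2`, so `|C_{k+1}| ≤ 2` and
`|T₄| ≤ 5`), whence both summability conjuncts of the named fact: `∑_k |c(p,k) p^{-(k+1)s}| < ∞`
for every prime `p` and `∑_p ∑_k |c(p,k) p^{-(k+1)s}| < ∞`. This is the elementary part of the
statement; the remaining content (entire continuation and the conductor-polynomial bound on
`|s - 2| ≤ 3/2`) is Kim's functoriality with the Kim–Shahidi cuspidality criterion and is NOT
proved here. [cite: KimShahidiCusp2002, §4 p. 194] -/
theorem Kim2003_symmFourL_nonCM_entire_polyBound.summable_logEuler (N : ℕ) [NeZero N]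
    (W : WeierstrassCurve ℚ) [W.IsElliptic] (f : CuspForm (Gamma0 N) 2) (hf : IsNewformOf W f)
    (s : ℂ) (hs : 1 < s.re) :
    (∀ p : Nat.Primes, Summable fun k : ℕ ↦
        ‖((if ¬ (p : ℕ) ∣ N then
              (((Polynomial.Chebyshev.C ℝ (k + 1)).eval ((cuspCoeff f p).re / Real.sqrt p)) ^ 4 -
                3 * ((Polynomial.Chebyshev.C ℝ (k + 1)).eval ((cuspCoeff f p).re / Real.sqrt p)) ^ 2 +
                  1) / (k + 1)
            else 0 : ℝ) : ℂ) * (p : ℂ) ^ (-((k + 1 : ℕ) : ℂ) * s)‖) ∧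
      (Summable fun p : Nat.Primes ↦ ∑' k : ℕ,
        ‖((if ¬ (p : ℕ) ∣ N then
              (((Polynomial.Chebyshev.C ℝ (k + 1)).eval ((cuspCoeff f p).re / Real.sqrt p)) ^ 4 -
                3 * ((Polynomial.Chebyshev.C ℝ (k + 1)).eval ((cuspCoeff f p).re / Real.sqrt p)) ^ 2 +
                  1) / (k + 1)
            else 0 : ℝ) : ℂ) * (p : ℂ) ^ (-((k + 1 : ℕ) : ℂ) * s)‖) := by
  refine summable_norm_mul_primePow_cpow (B := 5)
    (c := fun (p : Nat.Primes) (k : ℕ) ↦ (if ¬ (p : ℕ) ∣ N then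
      (((Polynomial.Chebyshev.C ℝ (k + 1)).eval ((cuspCoeff f p).re / Real.sqrt p)) ^ 4 -
        3 * ((Polynomial.Chebyshev.C ℝ (k + 1)).eval ((cuspCoeff f p).re / Real.sqrt p)) ^ 2 +
          1) / (k + 1) else 0 : ℝ)) (fun p k ↦ ?_) hs
  split_ifs with h
  · simp
  · have hx := abs_cuspCoeff_re_div_sqrt_le_two_of_isNewformOf W hf p.2
    have hT := abs_symmFourTrace_le_five (SymmSqLogEuler.abs_chebyshevC_eval_le hx (k + 1))
    have hk : (1 : ℝ) ≤ k + 1 := by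
      have : (0 : ℝ) ≤ k := Nat.cast_nonneg k
      linarith
    rw [abs_div, abs_of_pos (by positivity : (0 : ℝ) < k + 1), div_le_iff₀ (by positivity)]
    nlinarith [abs_nonneg ((((Polynomial.Chebyshev.C ℝ (k + 1)).eval
      ((cuspCoeff f p).re / Real.sqrt p)) ^ 4 -
        3 * ((Polynomial.Chebyshev.C ℝ (k + 1)).eval ((cuspCoeff f p).re / Real.sqrt p)) ^ 2 + 1))]

/-- **Reduction to the analytic core (proved).** `Kim2003_symmFourL_nonCM_entire_polyBound` is
equivalent to the same statement with the two `Re s > 1` summability conjuncts deleted (they hold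
unconditionally, `…summable_logEuler`): an entire `L₄` with `L₄ s = exp (∑_p ∑_k …)` on `Re s > 1`
and `‖L₄ s‖ ≤ C N^K` on `|s - 2| ≤ 3/2`. This isolates exactly what remains to be formalised
(module section docstring). [folklore] -/
theorem Kim2003_symmFourL_nonCM_entire_polyBound_iff_entire_continuation :
    Kim2003_symmFourL_nonCM_entire_polyBound ↔
      ∃ C K : ℝ, 1 ≤ C ∧ 0 ≤ K ∧
        ∀ (N : ℕ) [NeZero N] (W : WeierstrassCurve ℚ) [W.IsElliptic] (f : CuspForm (Gamma0 N) 2),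
          IsNewformOf W f → ¬ W.HasCM →
          ∃ L₄ : ℂ → ℂ, Differentiable ℂ L₄ ∧
            (∀ s : ℂ, 1 < s.re →
              L₄ s = Complex.exp (∑' p : Nat.Primes, ∑' k : ℕ,
                ((if ¬ (p : ℕ) ∣ N then
                      (((Polynomial.Chebyshev.C ℝ (k + 1)).eval ((cuspCoeff f p).re / Real.sqrt p)) ^ 4 -
                        3 * ((Polynomial.Chebyshev.C ℝ (k + 1)).eval
                          ((cuspCoeff f p).re / Real.sqrt p)) ^ 2 + 1) / (k + 1)
                    else 0 : ℝ) : ℂ) * (p : ℂ) ^ (-((k + 1 : ℕ) : ℂ) * s))) ∧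
            ∀ s ∈ closedBall (2 : ℂ) (3 / 2), ‖L₄ s‖ ≤ C * (N : ℝ) ^ K := by
  constructor
  · rintro ⟨C, K, hC, hK, hmain⟩
    refine ⟨C, K, hC, hK, fun N _ W _ f hf hCM ↦ ?_⟩
    obtain ⟨L₄, hdiff, hexp, hbound⟩ := hmain N W f hf hCM
    exact ⟨L₄, hdiff, fun s hs ↦ (hexp s hs).2.2, hbound⟩
  · rintro ⟨C, K, hC, hK, hmain⟩
    refine ⟨C, K, hC, hK, fun N _ W _ f hf hCM ↦ ?_⟩
    obtain ⟨L₄, hdiff, hexp, hbound⟩ := hmain N W f hf hCM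
    refine ⟨L₄, hdiff, fun s hs ↦ ?_, hbound⟩
    have hsum := Kim2003_symmFourL_nonCM_entire_polyBound.summable_logEuler N W f hf s hs
    exact ⟨hsum.1, hsum.2, hexp s hs⟩

end Literature.NumberTheory.Automorphic

end
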